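import Literature.Barriers.ResolutionOfSingularities.LocalMonomializationFailsLemmaShape
import HarnessLib

/-!
# Cutkosky's Lemma 3.1: conclusions (C2) and (C3) — the block of `p` transforms reproduces (4)

`Literature/Barriers/ResolutionOfSingularities/LocalMonomializationFailsLemmaBlock.lean` — second
file of the discharge of `Literature.Barriers.ResolutionOfSingularities.Cutkosky.CutkoskyLemma31`
(Cutkosky, Math. Ann. 362 (2015), Lemma 3.1). With `u = xᵖu₁`, `v = xv₂ + yᵖv₃`
(`LocalMonomializationFailsLemmaShape.lean`) and `x = x_pᵖ(y_p + α)`, `y = x_p` one has in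
`B_p = F[x_p,y_p]_{(x_p,y_p)}`: `v = x_pᵖ v₁` with `v₁ = (y_p+α)v₂ + v₃` a unit of residue
`c₁ = τ̄₀ + αe₀ ≠ 0`, `u = x_p^{p²}(y_p+α)ᵖ u₁`, hence `u/vᵖ = (y_p+α)ᵖ u₁ v₁^{−p} ∈ B_p` with
residue `β = αᵖc₀/c₁ᵖ`; so `u_p = v`, `v_p = u/vᵖ − β` lie in `𝔪_{B_p}`, which gives
**(C2)** `A_p ⊆ B_p` with domination, and the expansions **(C3)** = (5)
`u_p = x_pᵖ(c₁ + e₀ y_p + x_pΛ₁)`, `v_p = τ₁(y_p) y_pᵖ + e₁ x_p + x_pΩ₁` with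
`e₁ = αᵖf₀/c₁ᵖ`, `τ₁(0) = c₀(c₁ᵖ − αᵖe₀ᵖ)/c₁^{2p}` are read off by killing `x_p`
(`x_p = 0` kills both `x` and `y`, so restricts every element of `B` to its residue) and by the
Leibniz rule for the `x_p`-coefficient (which transports to the old `y`-coefficient).
[cite: Cutkosky2014, Lemma 3.1 (proof, "Now we consider factorization through `B_p` …")]
-/

noncomputable section

namespace Literature.Barriers.ResolutionOfSingularities

namespace Cutkosky

open Literature.AlgebraicGeometry.Resolution Literature.RingTheory.TwoVariableSeries IsLocalRing

universe u

variable {F : Type u} [Field F] {L : Type u} [Field L] [Algebra F L]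

/-! ## The power-series computation behind (5) -/

/-- `algebraMap F F[[t]]` is `C`. [folklore] -/
theorem powerSeries_algebraMap_apply (c : F) : algebraMap F (PowerSeries F) c = PowerSeries.C c := rfl

/-- **The expansions (5) from the series data.** In `F[[X,Y]]` (`X = x_p`, `Y = y_p`) let
`U = T_p u₁`, `V = T_p v₁`, `V⁻¹` be given with `V·V⁻¹ = 1`, restrictions to `X = 0`:
`U ↦ c₀`, `V ↦ c₁ + e₀ t` (`c₁ = τ̄₀ + αe₀`), and `coeff_X U = f₀`. Then
`V = c₁ + e₀Y + XΛ` for some `Λ`, and `Q = (Y+α)ᵖ U V^{−p} − β` (`β = αᵖc₀/c₁ᵖ`) has the form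
`τ₁(Y)Yᵖ + e₁X + XΩ` with `τ₁ ∈ F[[Y]]` a unit series, `e₁ = αᵖf₀/c₁ᵖ ≠ 0`, `Ω(0) = 0`.
[cite: Cutkosky2014, Lemma 3.1 (proof, expansions of `u_p`, `v_p`)] -/
theorem shape5_of_series (p : ℕ) [hp : Fact p.Prime] [CharP F p] {c₀ f₀ e₀ τb α : F} (hc : c₀ ≠ 0)
    (hf : f₀ ≠ 0) (hτ : τb ≠ 0) (hα : α ≠ 0) (hc₁ : τb + α * e₀ ≠ 0)
    {U V Vinv Q : MvPowerSeries (Fin 2) F} (hVinv : V * Vinv = 1)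
    (hκU : killVar 0 U = PowerSeries.C c₀)
    (hκV : killVar 0 V = PowerSeries.C (τb + α * e₀) + PowerSeries.C e₀ * PowerSeries.X)
    (hDU : MvPowerSeries.coeff (Finsupp.single 0 1) U = f₀)
    (hQ : Q = (MvPowerSeries.X 1 + MvPowerSeries.C α) ^ p * U * Vinv ^ p -
      MvPowerSeries.C (betaConst p c₀ e₀ τb α)) :
    (∃ Λ : MvPowerSeries (Fin 2) F, V = MvPowerSeries.C (τb + α * e₀) + MvPowerSeries.C e₀ * MvPowerSeries.X 1 +
        MvPowerSeries.X 0 * Λ) ∧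
    ∃ (e₁ : F) (τ₁ Ω : MvPowerSeries (Fin 2) F), e₁ ≠ 0 ∧ IsSeriesInY τ₁ ∧ MvPowerSeries.constantCoeff τ₁ ≠ 0 ∧
      MvPowerSeries.constantCoeff Ω = 0 ∧
      Q = τ₁ * MvPowerSeries.X 1 ^ p + MvPowerSeries.C e₁ * MvPowerSeries.X 0 + MvPowerSeries.X 0 * Ω := by
  haveI := charP_mvPowerSeries (R := F) (Fin 2) p
  haveI := charP_powerSeries (R := F) p
  have hp0 : p ≠ 0 := hp.out.ne_zero
  have hp2 : 2 ≤ p := hp.out.two_le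
  set c₁ := τb + α * e₀ with hc₁def
  set β := betaConst p c₀ e₀ τb α with hβ
  constructor
  · -- `X ∣ V - c₁ - e₀ Y`
    have hdvd : (MvPowerSeries.X 0 : MvPowerSeries (Fin 2) F) ∣
        V - MvPowerSeries.C c₁ - MvPowerSeries.C e₀ * MvPowerSeries.X 1 := by
      rw [← killVar_eq_zero_iff, map_sub, map_sub, hκV, map_mul, killVar_C, killVar_C, killVar_zero_X_one, sub_sub,
        sub_self]
    obtain ⟨Λ, hΛ⟩ := hdvd
    exact ⟨Λ, by rw [← hΛ]; ring⟩
  · -- the restriction of `Q` to `X = 0`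
    set ℓ : PowerSeries F := PowerSeries.C c₁ + PowerSeries.C e₀ * PowerSeries.X with hℓ
    set I : PowerSeries F := killVar 0 Vinv with hI
    have hℓI : ℓ * I = 1 := by rw [← hκV, hI, ← map_mul, hVinv, map_one]
    have hℓ0 : ℓ ≠ 0 := fun h0 => by rw [h0, zero_mul] at hℓI; exact zero_ne_one hℓI
    set κc : F := c₀ - β * e₀ ^ p with hκc
    have hκc0 : κc ≠ 0 := by
      intro h0
      rw [hκc, sub_eq_zero, hβ, betaConst, div_mul_eq_mul_div, eq_div_iff (pow_ne_zero _ hc₁)] at h0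
      -- `c₀ c₁ᵖ = αᵖ c₀ e₀ᵖ` forces `c₁ = α e₀`
      have h1 : c₁ ^ p = (α * e₀) ^ p := by
        rw [mul_pow]
        exact mul_left_cancel₀ hc (by linear_combination h0)
      have h2 : c₁ = α * e₀ := frobenius_inj F p h1
      rw [hc₁def] at h2
      exact hτ (by linear_combination h2)
    set σ₁ : PowerSeries F := PowerSeries.C κc * I ^ p with hσ₁
    have hfrobt : (PowerSeries.X + PowerSeries.C α : PowerSeries F) ^ p = PowerSeries.X ^ p + PowerSeries.C α ^ p :=
      add_pow_char _ _ _
    have hfrobℓ : ℓ ^ p = PowerSeries.C c₁ ^ p + PowerSeries.C e₀ ^ p * PowerSeries.X ^ p := by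
      rw [hℓ, add_pow_char, mul_pow]
    have hβc : β * c₁ ^ p = α ^ p * c₀ := by
      rw [hβ, betaConst, ← hc₁def, div_mul_cancel₀ _ (pow_ne_zero _ hc₁)]
    have hconst : PowerSeries.C α ^ p * PowerSeries.C c₀ - PowerSeries.C β * PowerSeries.C c₁ ^ p = (0 : PowerSeries F) := by
      have h := congrArg (PowerSeries.C (R := F)) hβc
      rw [map_mul, map_mul, map_pow, map_pow] at h
      linear_combination -h
    have hκQ : killVar 0 Q = PowerSeries.X ^ p * σ₁ := by
      have hq : killVar 0 Q = (PowerSeries.X + PowerSeries.C α) ^ p * PowerSeries.C c₀ * I ^ p - PowerSeries.C β := by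
        rw [hQ, map_sub, map_mul, map_mul, map_pow, map_pow, map_add, killVar_zero_X_one, killVar_C, hκU, killVar_C]
      apply mul_right_cancel₀ (pow_ne_zero p hℓ0)
      have e1 : ((PowerSeries.X + PowerSeries.C α) ^ p * PowerSeries.C c₀ * I ^ p - PowerSeries.C β) * ℓ ^ p =
          (PowerSeries.X + PowerSeries.C α) ^ p * PowerSeries.C c₀ * (ℓ * I) ^ p - PowerSeries.C β * ℓ ^ p := by ring
      have e2 : PowerSeries.X ^ p * σ₁ * ℓ ^ p = PowerSeries.X ^ p * PowerSeries.C κc * (ℓ * I) ^ p := by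
        rw [hσ₁]; ring
      rw [hq, e1, e2, hℓI, one_pow, mul_one, mul_one, hfrobt, hfrobℓ, hκc, map_sub, map_mul, map_pow]
      linear_combination hconst
    -- the series `τ₁`
    set τ₁ : MvPowerSeries (Fin 2) F := PowerSeries.toMvPowerSeries 1 σ₁ with hτ₁
    have hI0 : PowerSeries.constantCoeff I = c₁⁻¹ := by
      have h := congrArg PowerSeries.constantCoeff hℓI
      rw [map_mul, map_one, hℓ, map_add, map_mul, PowerSeries.constantCoeff_C, PowerSeries.constantCoeff_C,
        PowerSeries.constantCoeff_X, mul_zero, add_zero] at h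
      exact eq_inv_of_mul_eq_one_right h
    have hτ₁0 : MvPowerSeries.constantCoeff τ₁ = κc * (c₁⁻¹) ^ p := by
      rw [hτ₁, constantCoeff_toMvPowerSeries, hσ₁, map_mul, map_pow, PowerSeries.constantCoeff_C, hI0]
    have hτ₁Y : IsSeriesInY τ₁ := fun m hm => by
      rw [hτ₁]
      exact coeff_toMvPowerSeries_one_eq_zero σ₁ hm
    -- the coefficient `e₁`
    have hVinv0 : MvPowerSeries.constantCoeff Vinv = c₁⁻¹ := by
      rw [← constantCoeff_killVar 0, ← hI, hI0]
    set e₁ : F := α ^ p * f₀ * (c₁⁻¹) ^ p with he₁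
    have he₁0 : e₁ ≠ 0 := mul_ne_zero (mul_ne_zero (pow_ne_zero _ hα) hf) (pow_ne_zero _ (inv_ne_zero hc₁))
    have hDQ : MvPowerSeries.coeff (Finsupp.single 0 1) Q = e₁ := by
      rw [hQ, map_sub, coeff_single_one_C, sub_zero, coeff_single_one_mul, coeff_single_one_pow_eq_zero p 0 Vinv,
        mul_zero, zero_add, coeff_single_one_mul, coeff_single_one_pow_eq_zero p 0, zero_mul, add_zero, map_pow,
        map_pow, map_add, MvPowerSeries.constantCoeff_X, MvPowerSeries.constantCoeff_C, zero_add, hDU, hVinv0]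
    -- the remainder `Ω`
    have hdvd : (MvPowerSeries.X 0 : MvPowerSeries (Fin 2) F) ∣
        Q - τ₁ * MvPowerSeries.X 1 ^ p - MvPowerSeries.C e₁ * MvPowerSeries.X 0 := by
      rw [← killVar_eq_zero_iff, map_sub, map_sub, hκQ, map_mul, hτ₁, killVar_zero_toMvPowerSeries_one,
        killVar_zero_X_one_pow, map_mul, killVar_X_self, mul_zero, sub_zero, mul_comm, sub_self]
    obtain ⟨Ω, hΩ⟩ := hdvd
    have hΩ0 : MvPowerSeries.constantCoeff Ω = 0 := by
      have h := congrArg (MvPowerSeries.coeff (Finsupp.single 0 1)) hΩ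
      rw [coeff_single_one_X_mul, map_sub, map_sub, hDQ, mul_comm τ₁, coeff_single_zero_one_X_one_pow_mul hp0,
        sub_zero, MvPowerSeries.coeff_C_mul, coeff_single_one_X_self, mul_one, sub_self] at h
      exact h.symm
    exact ⟨e₁, τ₁, Ω, he₁0, hτ₁Y, by rw [hτ₁0]; exact mul_ne_zero hκc0 (pow_ne_zero _ (inv_ne_zero hc₁)), hΩ0,
      by rw [← hΩ]; ring⟩

/-! ## (C2) and (C3) -/

section C23

variable (p : ℕ) [hp : Fact p.Prime] [CharP F p] {a b : Fin 2 → L} (ha : AlgebraicIndependent F a)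
  (hb : AlgebraicIndependent F b) (hAB : originLocalRing ha ≤ originLocalRing hb)

/-- **(C2)–(C3) of Lemma 3.1.** With `β = αᵖc₀/(τ̄₀+αe₀)ᵖ`, the ring
`A_p = F[u_p,v_p]_{(u_p,v_p)}` (`u_p = v`, `v_p = u/vᵖ − β`) is contained in and dominated by
`B_p = F[x_p,y_p]_{(x_p,y_p)}` (`x_p = y`, `y_p = x/yᵖ − α`), and in `B̂_p` the expansions (5)
hold: `u_p = x_pᵖ(c₁ + f₁y_p + x_pΛ₁)`, `v_p = τ₁(y_p)y_pᵖ + e₁x_p + x_pΩ₁` with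
`c₁ = τ̄₀ + αe₀`, `f₁ = e₀`, `e₁ = αᵖf₀/c₁ᵖ` nonzero and `τ₁` a unit series in `y_p`.
[cite: Cutkosky2014, Lemma 3.1 ("The sequence of quadratic transforms of `A` which are dominated by `B_p` …", (5))] -/
theorem lemma31_C23 {c₀ f₀ e₀ : F} {τ₀ : MvPowerSeries (Fin 2) F}
    (hshape : LemmaShape p hb ⟨a 0, hAB (mem_originLocalRing_self ha 0)⟩
      ⟨a 1, hAB (mem_originLocalRing_self ha 1)⟩ c₀ f₀ e₀ τ₀)
    {α : F} (hα0 : α ≠ 0) (hα : α ≠ -(MvPowerSeries.constantCoeff τ₀) / e₀)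
    (hB : AlgebraicIndependent F (bCoord F L p (b 0) (b 1) α p))
    (hA : AlgebraicIndependent F
      (bCoord F L p (a 0) (a 1) (betaConst p c₀ e₀ (MvPowerSeries.constantCoeff τ₀) α) p)) :
    ∃ hle : originLocalRing hA ≤ originLocalRing hB,
      Dominates F L (originLocalRing hA) (originLocalRing hB) ∧
      ∃ (c₁ f₁ e₁ : F) (τ₁ : MvPowerSeries (Fin 2) F),
        LemmaShape p hB ⟨_, hle (mem_originLocalRing_self hA 0)⟩
          ⟨_, hle (mem_originLocalRing_self hA 1)⟩ c₁ f₁ e₁ τ₁ := by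
  classical
  haveI := isDomain_mvPowerSeries (F := F) (Fin 2)
  haveI := isLocalRing_originLocalRing hB
  have hp0 : p ≠ 0 := hp.out.ne_zero
  have hp2 : 2 ≤ p := hp.out.two_le
  obtain ⟨u₁, v₂, v₃, hu, hv, hu₁, hDu₁, hv₂, hv₃⟩ := exists_decomp_of_lemmaShape hb hp0 hshape
  obtain ⟨hc, hf, he, hτY, hτ0, -, -⟩ := hshape
  obtain ⟨hleB, hmaxB, hTx, hTy⟩ := le_Bp p hb α hp0 hB
  set τb := MvPowerSeries.constantCoeff τ₀ with hτb
  set β := betaConst p c₀ e₀ τb α with hβ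
  have hc₁ : τb + α * e₀ ≠ 0 := by
    intro h0
    apply hα
    rw [eq_div_iff he]
    linear_combination h0
  -- notation for `B_p`
  set T := originTaylorAt hB with hT
  set ι : originLocalRing hb →ₐ[F] originLocalRing hB := Subalgebra.inclusion hleB with hι
  have hιx : ι (originCoord hb 0) = originCoord hB 0 ^ p * (originCoord hB 1 + algebraMap F _ α) := by
    apply Subtype.ext
    have hy : b 1 ≠ 0 := by simpa using hb.ne_zero 1
    exact ((bCoord_subst_self (F := F) p (b 0) (b 1) hy α).1).symm
  have hιy : ι (originCoord hb 1) = originCoord hB 0 := by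
    apply Subtype.ext
    have hy : b 1 ≠ 0 := by simpa using hb.ne_zero 1
    exact ((bCoord_subst_self (F := F) p (b 0) (b 1) hy α).2).symm
  have hTxp : T (originCoord hB 0) = MvPowerSeries.X 0 := originTaylorAt_coord hB 0
  have hTyp : T (originCoord hB 1) = MvPowerSeries.X 1 := originTaylorAt_coord hB 1
  have hTalg : ∀ c : F, T (algebraMap F _ c) = MvPowerSeries.C c := originTaylorAt_algebraMap hB
  -- transported residues, restrictions and first-order coefficients
  have hres : ∀ w : originLocalRing hb, MvPowerSeries.constantCoeff (T (ι w)) =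
      MvPowerSeries.constantCoeff (originTaylorAt hb w) := fun w =>
    constantCoeff_originTaylorAt_inclusion hb hB hleB hmaxB w.2
  have hκι : ∀ w : originLocalRing hb, killVar 0 (T (ι w)) =
      PowerSeries.C (MvPowerSeries.constantCoeff (originTaylorAt hb w)) := by
    intro w
    have h := map_originTaylorAt_inclusion_eq_residue hb hB hleB (ψ := killVar 0) (fun i => ?_) w.2
    · exact h
    fin_cases i
    · change killVar 0 (originTaylorAt hB ⟨b 0, _⟩) = 0
      rw [hTx, map_mul, map_pow, killVar_X_self, zero_pow hp0, zero_mul]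
    · change killVar 0 (originTaylorAt hB ⟨b 1, _⟩) = 0
      rw [hTy, killVar_X_self]
  have hDι : MvPowerSeries.coeff (Finsupp.single 0 1) (T (ι u₁)) = f₀ := by
    have h := coeff_single_one_originTaylorAt_inclusion hb hB hleB 1 0 hmaxB (fun i => ?_) u₁.2
    · rw [← hDu₁]; exact h
    fin_cases i
    · change MvPowerSeries.coeff (Finsupp.single 0 1) (originTaylorAt hB ⟨b 0, _⟩) =
        MvPowerSeries.coeff (Finsupp.single 1 1) (MvPowerSeries.X 0)
      rw [hTx, coeff_single_one_X_self_pow_mul hp2, coeff_single_one_one_X_zero]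
    · change MvPowerSeries.coeff (Finsupp.single 0 1) (originTaylorAt hB ⟨b 1, _⟩) =
        MvPowerSeries.coeff (Finsupp.single 1 1) (MvPowerSeries.X 1)
      rw [hTy, coeff_single_one_X_self, coeff_single_one_X_self]
  -- the unit `v₁` and `v = x_pᵖ v₁`
  set v₁ : originLocalRing hB := (originCoord hB 1 + algebraMap F _ α) * ι v₂ + ι v₃ with hv₁
  have hιv : ι ⟨a 1, hAB (mem_originLocalRing_self ha 1)⟩ = originCoord hB 0 ^ p * v₁ := by
    rw [hv, map_add, map_mul, map_mul, map_pow, hιx, hιy, hv₁]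
    ring
  have hιu : ι ⟨a 0, hAB (mem_originLocalRing_self ha 0)⟩ =
      originCoord hB 0 ^ (p * p) * (originCoord hB 1 + algebraMap F _ α) ^ p * ι u₁ := by
    rw [hu, map_mul, map_pow, hιx, mul_pow, ← pow_mul]
  have hTv₁ : T v₁ = (MvPowerSeries.X 1 + MvPowerSeries.C α) * T (ι v₂) + T (ι v₃) := by
    rw [hv₁, map_add, map_mul, map_add, hTyp, hTalg]
  have hV0 : MvPowerSeries.constantCoeff (T v₁) = τb + α * e₀ := by
    rw [hTv₁, map_add, map_mul, map_add, MvPowerSeries.constantCoeff_X, MvPowerSeries.constantCoeff_C, hres, hres,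
      hv₂, hv₃, zero_add]
    ring
  have hv₁unit : IsUnit v₁ := (constantCoeff_originTaylorAt_ne_zero_iff hB v₁).mp (by rw [← hT, hV0]; exact hc₁)
  obtain ⟨w₁, hw₁⟩ := hv₁unit
  have hVinv : T v₁ * T (↑w₁⁻¹ : originLocalRing hB) = 1 := by
    rw [← map_mul, ← hw₁, Units.mul_inv, map_one]
  have hκV : killVar 0 (T v₁) = PowerSeries.C (τb + α * e₀) + PowerSeries.C e₀ * PowerSeries.X := by
    rw [hTv₁, map_add, map_mul, map_add, killVar_zero_X_one, killVar_C, hκι, hκι, hv₂, hv₃, map_add, map_mul]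
    ring
  -- the element `v_p = u/vᵖ − β` of `B_p`
  set vpB : originLocalRing hB :=
    (originCoord hB 1 + algebraMap F _ α) ^ p * ι u₁ * (↑w₁⁻¹ : originLocalRing hB) ^ p - algebraMap F _ β with hvpB
  have hv₁val : ((v₁ : originLocalRing hB) : L) ≠ 0 := by
    intro h0
    have : v₁ = 0 := Subtype.ext h0
    rw [this] at hV0
    rw [map_zero, map_zero] at hV0
    exact hc₁ hV0.symm
  have hb1 : b 1 ≠ 0 := by simpa using hb.ne_zero 1
  have hxpval : ((originCoord hB 0 : originLocalRing hB) : L) = b 1 := by simp [bCoord]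
  have hypval : ((originCoord hB 1 : originLocalRing hB) : L) = b 0 / b 1 ^ p - algebraMap F L α := by simp [bCoord]
  have hwinv : ((↑w₁⁻¹ : originLocalRing hB) : L) = ((v₁ : originLocalRing hB) : L)⁻¹ := by
    rw [coe_units_inv_subalgebra, hw₁]
  have hιval : ∀ w : originLocalRing hb, ((ι w : originLocalRing hB) : L) = (w : L) := fun w => rfl
  have hvpval : (vpB : L) = a 0 / a 1 ^ p - algebraMap F L β := by
    have hua : (a 0 : L) = (b 1) ^ (p * p) * (b 0 / b 1 ^ p) ^ p * (u₁ : L) := by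
      have h : ((ι ⟨a 0, hAB (mem_originLocalRing_self ha 0)⟩ : originLocalRing hB) : L) =
          ((originCoord hB 0 ^ (p * p) * (originCoord hB 1 + algebraMap F _ α) ^ p * ι u₁ : originLocalRing hB) : L) :=
        congrArg Subtype.val hιu
      rw [Subalgebra.coe_mul, Subalgebra.coe_mul, Subalgebra.coe_pow, Subalgebra.coe_pow, Subalgebra.coe_add,
        Subalgebra.coe_algebraMap, hxpval, hypval, hιval, hιval, sub_add_cancel] at h
      exact h
    have hva : (a 1 : L) = (b 1) ^ p * (v₁ : L) := by
      have h : ((ι ⟨a 1, hAB (mem_originLocalRing_self ha 1)⟩ : originLocalRing hB) : L) =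
          ((originCoord hB 0 ^ p * v₁ : originLocalRing hB) : L) := congrArg Subtype.val hιv
      rw [Subalgebra.coe_mul, Subalgebra.coe_pow, hxpval, hιval] at h
      exact h
    have hcoe : (vpB : L) = (b 0 / b 1 ^ p) ^ p * (u₁ : L) * (((v₁ : originLocalRing hB) : L)⁻¹) ^ p - algebraMap F L β := by
      rw [hvpB, Subalgebra.coe_sub, Subalgebra.coe_mul, Subalgebra.coe_mul, Subalgebra.coe_pow, Subalgebra.coe_pow,
        Subalgebra.coe_add, Subalgebra.coe_algebraMap, Subalgebra.coe_algebraMap, hypval, hιval, hwinv, sub_add_cancel]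
    rw [hcoe, hua, hva]
    congr 1
    have hb1p : (b 1 : L) ^ (p * p) ≠ 0 := pow_ne_zero _ hb1
    have hv1p : ((v₁ : originLocalRing hB) : L) ^ p ≠ 0 := pow_ne_zero _ hv₁val
    rw [mul_pow, ← pow_mul, inv_pow, eq_div_iff (mul_ne_zero hb1p hv1p)]
    field_simp
  -- memberships and maximal-ideal memberships of the coordinates of `A_p`
  have hval0 : bCoord F L p (a 0) (a 1) β p 0 = a 1 := by
    rw [bCoord_self, Matrix.cons_val_zero]
  have hval1 : bCoord F L p (a 0) (a 1) β p 1 = a 0 / a 1 ^ p - algebraMap F L β := by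
    rw [bCoord_self, Matrix.cons_val_one, Matrix.cons_val_fin_one]
  have hmemA : ∀ j, bCoord F L p (a 0) (a 1) β p j ∈ originLocalRing hB := by
    refine Fin.forall_fin_two.mpr ⟨?_, ?_⟩
    · rw [hval0]
      exact hleB (hAB (mem_originLocalRing_self ha 1))
    · rw [hval1, ← hvpval]
      exact vpB.2
  have he0 : (⟨bCoord F L p (a 0) (a 1) β p 0, hmemA 0⟩ : originLocalRing hB) = originCoord hB 0 ^ p * v₁ := by
    rw [← hιv]
    exact Subtype.ext hval0
  have he1 : (⟨bCoord F L p (a 0) (a 1) β p 1, hmemA 1⟩ : originLocalRing hB) = vpB :=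
    Subtype.ext (hval1.trans hvpval.symm)
  have hTvp : T vpB = (MvPowerSeries.X 1 + MvPowerSeries.C α) ^ p * T (ι u₁) * T (↑w₁⁻¹ : originLocalRing hB) ^ p -
      MvPowerSeries.C β := by
    rw [hvpB, map_sub, map_mul, map_mul, map_pow, map_pow, map_add, hTyp, hTalg, hTalg]
  have hVinv0 : MvPowerSeries.constantCoeff (T (↑w₁⁻¹ : originLocalRing hB)) = (τb + α * e₀)⁻¹ := by
    have h := congrArg MvPowerSeries.constantCoeff hVinv
    rw [map_mul, map_one, hV0] at h
    exact eq_inv_of_mul_eq_one_right h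
  have hmaxA : ∀ j, (⟨bCoord F L p (a 0) (a 1) β p j, hmemA j⟩ : originLocalRing hB) ∈ maximalIdeal (originLocalRing hB) := by
    intro j
    rw [← constantCoeff_originTaylorAt_eq_zero_iff]
    fin_cases j
    · change MvPowerSeries.constantCoeff (T ⟨bCoord F L p (a 0) (a 1) β p 0, hmemA 0⟩) = 0
      rw [he0, map_mul, map_pow, hTxp, map_mul, map_pow, MvPowerSeries.constantCoeff_X, zero_pow hp0, zero_mul]
    · change MvPowerSeries.constantCoeff (T ⟨bCoord F L p (a 0) (a 1) β p 1, hmemA 1⟩) = 0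
      rw [he1, hTvp, map_sub, map_mul, map_mul, map_pow, map_pow, map_add, MvPowerSeries.constantCoeff_X,
        MvPowerSeries.constantCoeff_C, MvPowerSeries.constantCoeff_C, zero_add, hres, hu₁, hVinv0, hβ, betaConst,
        inv_pow, div_eq_mul_inv]
      ring
  have hle : originLocalRing hA ≤ originLocalRing hB :=
    originLocalRing_le_of_forall_mem_maximalIdeal hA hB hmemA hmaxA
  have hdom : Dominates F L (originLocalRing hA) (originLocalRing hB) :=
    ⟨hle, fun _ hq hinv => inv_mem_originLocalRing_of_forall_mem_maximalIdeal hA hB hmemA hmaxA hq hinv⟩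
  -- the expansions (5)
  obtain ⟨⟨Λ, hΛ⟩, e₁, τ₁, Ω, he₁, hτ₁Y, hτ₁0, hΩ0, hQ⟩ :=
    shape5_of_series (F := F) p hc hf hτ0 hα0 hc₁ hVinv (by rw [hκι, hu₁]) hκV hDι hTvp
  have hE0 : (⟨bCoord F L p (a 0) (a 1) β p 0, hle (mem_originLocalRing_self hA 0)⟩ : originLocalRing hB) =
      originCoord hB 0 ^ p * v₁ := by
    rw [← hιv]
    exact Subtype.ext hval0
  have hE1 : (⟨bCoord F L p (a 0) (a 1) β p 1, hle (mem_originLocalRing_self hA 1)⟩ : originLocalRing hB) = vpB :=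
    Subtype.ext (hval1.trans hvpval.symm)
  refine ⟨hle, hdom, τb + α * e₀, e₀, e₁, τ₁, hc₁, he, he₁, hτ₁Y, hτ₁0, ⟨Λ, ?_⟩, ⟨Ω, hΩ0, ?_⟩⟩
  · rw [hE0, map_mul, map_pow, hTxp, hΛ]
  · rw [hE1, hQ]

end C23

end Cutkosky

end Literature.Barriers.ResolutionOfSingularities
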